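import Literature.NumberTheory.Automorphic.UnitaryGroupTruncatedTracePolynomialOfSiegel
import Literature.NumberTheory.Automorphic.UnitaryGroupTruncatedKernelIntegrableHolds
import HarnessLib

/-!
# The T1-qs law `UnitaryGroup.TruncatedTracePolynomial` HOLDS for `U(J₃)` of a CM field: `J^T(f)` is a
# polynomial in `log T` of degree `≤ 1` (Arthur 1981, Prop. 2.3; Rogawski 1990, §2.1; Shokranian 1992, Thm. 5.7)

Topic `NumberTheory/Automorphic`; namespace `Literature.NumberTheory.Automorphic.UnitaryGroup`. THEOREMS ONLY over
accepted tree modules: no definition, no named fact, no instance, no notation, no `sorry`. The last file of the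
T1-qs LAW 2 road (cell `pub/hodgecm-mathlib`, crux H413, line `Cruxes/H413/Lines/F0_T1InnerFormTraceIdentity.lean`):
★ `truncatedTracePolynomial_of_truncatedKernelIntegrable` (LAW 2 ⇐ LAW 1) composed with ★ LAW 1
`truncatedKernelIntegrable_of_unimodular_iwasawa` ∕ `truncatedKernelIntegrable_cm`
(`UnitaryGroupTruncatedKernelIntegrableHolds`).

* `truncatedTracePolynomial_of_unimodular_iwasawa` — for a quadratic `E/F` with `c² = 1 ≠ c`, unimodularity of
  `U(J₃)(𝔸_F)` and the adelic Iwasawa decomposition: `TruncatedTracePolynomial F E c`.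
* **`truncatedTracePolynomial_cm`** — `TruncatedTracePolynomial (↥(maximalRealSubfield L)) L (complexConj L)` for
  every CM field `L`, NO HYPOTHESIS: the named fact `UnitaryGroup.TruncatedTracePolynomial` of ★
  `UnitaryGroupArthurTruncatedTrace` (:302) at the line's `G = U(Φ₃)`.

## References

* J. Arthur, *The trace formula in invariant form*, Ann. of Math. 114 (1981), Prop. 2.3
  [Arthur1981TraceFormulaInvariantForm].
* J. D. Rogawski, *Automorphic Representations of Unitary Groups in Three Variables*, Annals of Mathematics
  Studies 123 (1990), §2.1 (p. 12) [Rogawski1990].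
* S. Shokranian, *The Selberg–Arthur Trace Formula*, LNM 1503 (1992), Thm. (5.7), Rem. (5.8) [Shokranian1992].
-/

set_option autoImplicit false

noncomputable section

open MeasureTheory Measure NumberField IsDedekindDomain Set
open scoped NNReal ENNReal

namespace Literature.NumberTheory.Automorphic

namespace UnitaryGroup

variable {F E : Type} [Field F] [NumberField F] [Field E] [NumberField E] [Algebra F E]
  {c : E ≃ₐ[F] E}

/-- **`TruncatedTracePolynomial F E c` for a quadratic `E/F`** (`c² = 1 ≠ c`, `[E:F] = 2`), from unimodularity of
`U(J₃)(𝔸_F)` and the adelic Iwasawa decomposition alone: ★ LAW 1 `truncatedKernelIntegrable_of_unimodular_iwasawa`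
fed into ★ `truncatedTracePolynomial_of_truncatedKernelIntegrable`. [cite: Arthur1981TraceFormulaInvariantForm, Prop. 2.3]
[cite: Rogawski1990, §2.1 (p. 12)] [cite: Shokranian1992, Thm. (5.7) and Rem. (5.8)] -/
theorem truncatedTracePolynomial_of_unimodular_iwasawa (hc : c * c = 1) (hc1 : c ≠ 1)
    (h2 : Module.finrank F E = 2)
    (hunimod : ∀ [MeasurableSpace (quasiSplit F E c 3).Adelic] [BorelSpace (quasiSplit F E c 3).Adelic]
      (νG : Measure (quasiSplit F E c 3).Adelic), νG.IsHaarMeasure → νG.IsMulRightInvariant)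
    (hBK : ∀ g : (quasiSplit F E c 3).Adelic, ∃ b ∈ borelAdelic F E c 3, ∃ k : (quasiSplit F E c 3).Adelic,
      adelicVal F E c 3 ((StdForm.antidiagonal 3).over E) k ∈ standardMaximalCompactGL 3 E ∧ g = b * k) :
    TruncatedTracePolynomial F E c :=
  truncatedTracePolynomial_of_truncatedKernelIntegrable hc hc1 h2 hunimod hBK
    (truncatedKernelIntegrable_of_unimodular_iwasawa hc hc1 h2 hunimod hBK)

/-- **THE LAW HOLDS: `J^T(f)` IS A POLYNOMIAL IN `log T` OF DEGREE `≤ 1` on `U(J₃)` of a CM field** — the named fact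
★ `UnitaryGroup.TruncatedTracePolynomial` at `(L⁺, L, complexConj)`, with NO hypothesis: for every Haar measure `ν`
of `N(𝔸)`, fundamental domain `𝓕` of `N(F)`, automorphic measure `μ` and quasi-split test function `f` there is
`p ∈ ℂ[X]`, `deg p ≤ 1`, with `J^T(f) = p(log T)` for all large `T` (Rogawski (1990), §2.1 «each term in (2.1.1) is a
polynomial in `T`»; Arthur (1981), Prop. 2.3; Shokranian (1992), Thm. (5.7), Rem. (5.8): degree `dim(A_B/A_G) = 1`).
★ LAW 1 `truncatedKernelIntegrable_cm` ∘ ★ `truncatedTracePolynomial_cm_of_truncatedKernelIntegrable`.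
[cite: Rogawski1990, §2.1 (p. 12)] [cite: Arthur1981TraceFormulaInvariantForm, Prop. 2.3]
[cite: Shokranian1992, Thm. (5.7) and Rem. (5.8)] -/
theorem truncatedTracePolynomial_cm (L : Type) [Field L] [NumberField L] [IsCMField L] :
    TruncatedTracePolynomial (↥(maximalRealSubfield L)) L (IsCMField.complexConj L) :=
  truncatedTracePolynomial_cm_of_truncatedKernelIntegrable L (truncatedKernelIntegrable_cm L)

end UnitaryGroup

end Literature.NumberTheory.Automorphic
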